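import Mathlib
import Summits.ValiantsHypothesis.ValiantsHypothesis.Theorems.GeneratorObstructionsPowGenDegreeQPBorelDense
import Summits.ValiantsHypothesis.ValiantsHypothesis.Theorems.GeneratorObstructionsPowGenDegreeQPLinearFormMoves
import Summits.ValiantsHypothesis.ValiantsHypothesis.Theorems.GeneratorObstructionsPowGenDegreeQPWideRegime
import Literature.Computability.AlgebraicComplexity.OrbitMultiplicitySemigroup

/-!
# K2 `PowGenDegreeQP` (stmt-ValiantsHypothesis-11655), line `trace-side-regimes`, row `m = 1`:
# Borel density, stabiliser weights and generator types of a linear form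

Helper file (`--supports stmt-ValiantsHypothesis-11655`), second of three for the row `m = 1`
(`…LinearFormMoves` → this → `…RowOne`).  For a linear form `ℓ = ∑ c_u X_u` with nonzero coefficient
at the greatest letter `T`, over an infinite field (characteristic zero for the weight statements):

* `dense_linearForm` — the orbit point `ℓ` is BOREL-DENSE in `Δ_1 ℓ = Sym¹` (hypothesis `hdense` of
  `…PowGenDegreeQPBorelDense`): a class vanishing at all `b · ℓ`, `b` upper triangular, vanishes at
  all coefficient vectors `w` with `w_T ≠ 0`, so `F · X_T = 0` and `F = 0`;
* `apply_eq_zero_of_occurs_of_ne_top`, `eq_single_top_of_occurs` — occurring weights of `k[Δ_1 ℓ]`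
  are multiples of `ε_T` (the stabilisers `b_u(2)` force `2^{χ_u} = 1`);
* `hasHighestWeight_single_top_neg` — all `-j ε_T`, `j ≥ 1`, occur (powers of `X_T`);
* `neg_size_le_one_of_genType_linearForm` — **every generator type of `A(Δ_1 ℓ)` has `-|χ| ≤ 1`**
  (`χ ∈ {0, -ε_T}`): a weight `-D ε_T` with `D ≥ 2` splits into the occurring `-ε_T`, `-(D-1)ε_T`
  and is killed by `atom_of_genType_of_dense`.
-/

namespace Summit.ValiantsHypothesis.ValiantsHypothesis.Theorems.GeneratorObstructions.PowGenDegreeQP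

open MvPolynomial
open Literature.NumberTheory.DiophantineGeometry Literature.Computability.AlgebraicComplexity

-- `Summit.ValiantsHypothesis.ValiantsHypothesis.…` is the tree's mandated single-conjunct layout.
set_option linter.dupNamespace false

noncomputable section

/-! ## 3. Borel density and stabiliser weights for linear forms (`m = 1`) -/

section DegreeOne

variable {σ k : Type*} [Fintype σ] [LinearOrder σ] [Field k]

/-- **The orbit point of a linear form with nonzero top coefficient is Borel-dense in `Sym¹`.**
For `ℓ = ∑ c_u X_u` with `c_T ≠ 0` (`T` the greatest letter): a class of `k[Δ_1 ℓ]` vanishing at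
every `b · ℓ`, `b` upper triangular, is zero. Its representative `F` vanishes at every coefficient
vector `w` with `w_T ≠ 0` (`exists_upperTriangular_mulVec_eq`), so `F · X_T` vanishes everywhere,
`F · X_T = 0` (`MvPolynomial.funext`, infinite field), `F = 0`. [folklore] -/
theorem dense_linearForm [Infinite k] {T : σ} (hT : ∀ i, i ≤ T) {c : σ → k} (hc : c T ≠ 0) :
    ∀ x : OrbitCoordRing (∑ v, c v • (X v : MvPolynomial σ k)) 1,
      (∀ b : GL σ k, IsUpperTriangular b →
        evalAtPoint (∑ v, c v • (X v : MvPolynomial σ k)) 1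
          (orbitCoordRep (∑ v, c v • (X v : MvPolynomial σ k)) 1 (b * 1)⁻¹ x) = 0) →
      x = 0 := by
  classical
  intro x hx
  obtain ⟨F, rfl⟩ := Ideal.Quotient.mk_surjective x
  set dT : DegIdx σ 1 := ⟨Finsupp.single T 1, mem_degMonomials_iff.mpr (Finsupp.degree_single T 1)⟩
    with hdT
  -- `F` vanishes at every point with nonzero `T`-coordinate
  have hvan : ∀ p : DegIdx σ 1 → k, p dT ≠ 0 → aeval p F = 0 := by
    intro p hp
    set w : σ → k := fun u =>
      p ⟨Finsupp.single u 1, mem_degMonomials_iff.mpr (Finsupp.degree_single u 1)⟩ with hw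
    have hwT : w T ≠ 0 := hp
    obtain ⟨b, hb, hbc⟩ := exists_upperTriangular_mulVec_eq hT hc hwT
    have h := hx b hb
    rw [mul_one, evalAtPoint_orbitCoordRep_inv_mk, linSubstRep_apply, linSubst_sum_smul_X, hbc,
      formCoeff_one_sum_smul_X_eq] at h
    exact h
  -- hence `F · X_T = 0` and `F = 0`
  have hFX : F * X dT = 0 := by
    apply MvPolynomial.funext
    intro p
    rw [map_mul, map_zero, eval_X]
    by_cases hp : p dT = 0
    · rw [hp, mul_zero]
    · have h := hvan p hp
      rw [show eval p F = aeval p F from rfl, h, zero_mul]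
  have hF : F = 0 := by
    rcases mul_eq_zero.mp hFX with h | h
    · exact h
    · exact absurd h (X_ne_zero dT)
  rw [hF, map_zero]

/-- **Occurring weights of a linear form are supported at the top letter.** For `ℓ = ∑ c_u X_u`
with `c_T ≠ 0` (characteristic zero) and a weight `χ` occurring in `k[Δ_1 ℓ]`, `χ_u = 0` for every
`u ≠ T`: the upper triangular `b_u(2)` fixes `ℓ` and has `χ(b_u(2)) = 2^{χ_u}`, which is `1` by
`weightChar_eq_one_of_fix_of_dense`. [folklore] -/
theorem apply_eq_zero_of_occurs_of_ne_top [CharZero k] {T : σ} (hT : ∀ i, i ≤ T) {c : σ → k}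
    (hc : c T ≠ 0) {χ : Weight σ}
    (hχ : highestWeightSpace (orbitCoordRep (∑ v, c v • (X v : MvPolynomial σ k)) 1) χ ≠ ⊥)
    {u : σ} (hu : u ≠ T) : χ u = 0 := by
  classical
  haveI : Infinite k := CharZero.infinite k
  obtain ⟨b, hb, hbc, hbdiag⟩ :=
    exists_upperTriangular_fix_diag hT hc hu (two_ne_zero : (2 : k) ≠ 0)
  have hfix : linSubstRep σ k (b * 1) (∑ v, c v • (X v : MvPolynomial σ k)) =
      linSubstRep σ k 1 (∑ v, c v • (X v : MvPolynomial σ k)) := by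
    rw [mul_one, map_one, Module.End.one_apply, linSubstRep_apply, linSubst_sum_smul_X, hbc]
  have h1 := weightChar_eq_one_of_fix_of_dense (dense_linearForm hT hc) hb hfix hχ
  have h2 : weightChar χ b = (2 : k) ^ (χ u) := by
    rw [weightChar]
    rw [Finset.prod_eq_single u (fun i _ hi => by rw [hbdiag, if_neg hi, one_zpow])
      (fun h => absurd (Finset.mem_univ u) h), hbdiag, if_pos rfl]
  rw [h2] at h1
  -- `2 ^ z = 1` in characteristic zero forces `z = 0`
  rcases le_or_gt 0 (χ u) with h0 | h0
  · obtain ⟨n, hn⟩ := Int.eq_ofNat_of_zero_le h0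
    rw [hn, zpow_natCast] at h1
    have h3 : (2 : ℕ) ^ n = 1 := by exact_mod_cast h1
    have h4 : n = 0 := by
      by_contra hn0
      have : 2 ≤ (2 : ℕ) ^ n := Nat.le_self_pow hn0 2
      omega
    rw [hn, h4]; rfl
  · exfalso
    obtain ⟨n, hn⟩ := Int.exists_eq_neg_ofNat (le_of_lt h0)
    rw [hn, zpow_neg, zpow_natCast, inv_eq_one] at h1
    have h3 : (2 : ℕ) ^ n = 1 := by exact_mod_cast h1
    have h4 : n = 0 := by
      by_contra hn0
      have : 2 ≤ (2 : ℕ) ^ n := Nat.le_self_pow hn0 2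
      omega
    rw [hn, h4] at h0
    simp at h0

/-- **Occurring weights of a linear form are multiples of `ε_T`**: `χ = χ_T · ε_T`. [folklore] -/
theorem eq_single_top_of_occurs [CharZero k] {T : σ} (hT : ∀ i, i ≤ T) {c : σ → k} (hc : c T ≠ 0)
    {χ : Weight σ}
    (hχ : highestWeightSpace (orbitCoordRep (∑ v, c v • (X v : MvPolynomial σ k)) 1) χ ≠ ⊥) :
    χ = Pi.single T (χ T) := by
  funext u
  by_cases hu : u = T
  · subst hu; rw [Pi.single_eq_same]
  · rw [Pi.single_eq_of_ne hu, apply_eq_zero_of_occurs_of_ne_top hT hc hχ hu]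

/-- **All negative multiples of `ε_T` occur** in `k[Δ_1 ℓ]` for a nonzero linear form `ℓ`: the
powers `X_T^j` of the top coordinate (`hasHighestWeight_orbitCoordRep_single_top` and the semigroup
property `HasHighestWeight.add_of_orbitCoordRep`). [folklore] -/
theorem hasHighestWeight_single_top_neg [Infinite k] {T : σ} (hT : ∀ i, i ≤ T)
    {ℓ : MvPolynomial σ k} (hℓ : ℓ.IsHomogeneous 1) (hℓ0 : ℓ ≠ 0) (j : ℕ) (hj : 1 ≤ j) :
    HasHighestWeight (orbitCoordRep ℓ 1) (Pi.single T (-(j : ℤ))) := by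
  induction j with
  | zero => exact absurd hj (by norm_num)
  | succ j ih =>
    have h1 : HasHighestWeight (orbitCoordRep ℓ 1) (Pi.single T (-(1 : ℤ))) := by
      have := hasHighestWeight_orbitCoordRep_single_top hℓ hℓ0 T hT
      simpa using this
    rcases Nat.eq_zero_or_pos j with hj0 | hjpos
    · subst hj0; simpa using h1
    · have hj' := ih hjpos
      have hsum : Pi.single T (-((j + 1 : ℕ) : ℤ)) =
          (Pi.single T (-(j : ℤ)) : Weight σ) + Pi.single T (-(1 : ℤ)) := by
        rw [← Pi.single_add]
        congr 1
        push_cast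
        ring
      rw [hsum]
      exact Literature.NumberTheory.DiophantineGeometry.HasHighestWeight.add_of_orbitCoordRep ℓ 1 hj' h1

/-- **Generator types of a Borel-dense linear form have degree at most one.** For
`ℓ = ∑ c_u X_u` with `c_T ≠ 0` over a field of characteristic zero: if `γ_χ(Δ_1 ℓ) ≠ 0` then
`-|χ| ≤ 1` (indeed `χ ∈ {0, -ε_T}`): `χ = -D ε_T` by `eq_single_top_of_occurs` and nonpositivity,
and `D ≥ 2` would split `χ = -ε_T + -(D-1)ε_T` into two nonzero occurring weights, contradicting
`atom_of_genType_of_dense`. [folklore] -/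
theorem neg_size_le_one_of_genType_linearForm [CharZero k] {T : σ} (hT : ∀ i, i ≤ T)
    {c : σ → k} (hc : c T ≠ 0) {χ : Weight σ}
    (hγ : Module.finrank k
      (↥(highestWeightSpace (orbitCoordRep (∑ v, c v • (X v : MvPolynomial σ k)) 1) χ) ⧸
        Submodule.comap (highestWeightSpace (orbitCoordRep (∑ v, c v • (X v : MvPolynomial σ k)) 1) χ).subtype
          (⨆ p : Weight σ × Weight σ, ⨆ (_ : p.1 + p.2 = χ ∧ p.1 ≠ 0 ∧ p.2 ≠ 0),
            highestWeightSpace (orbitCoordRep (∑ v, c v • (X v : MvPolynomial σ k)) 1) p.1 *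
              highestWeightSpace (orbitCoordRep (∑ v, c v • (X v : MvPolynomial σ k)) 1) p.2)) ≠ 0) :
    -(Weight.size χ) ≤ 1 := by
  classical
  haveI : Infinite k := CharZero.infinite k
  set ℓ : MvPolynomial σ k := ∑ v, c v • (X v : MvPolynomial σ k) with hℓdef
  have hocc : highestWeightSpace (orbitCoordRep ℓ 1) χ ≠ ⊥ := ne_bot_of_finrank_quotient_ne_zero _ _ hγ
  have hχ := eq_single_top_of_occurs hT hc hocc
  -- nonpositivity: `χ_T = -D`
  obtain ⟨hle, -⟩ := nonpos_and_exists_size_eq_of_hasHighestWeight_orbitCoordRep ℓ hocc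
  have hsize : Weight.size χ = χ T := by
    conv_lhs => rw [Weight.size, hχ]
    rw [Finset.sum_eq_single T (fun i _ hi => by rw [Pi.single_eq_of_ne hi])
      (fun h => absurd (Finset.mem_univ T) h)]
    rw [Pi.single_eq_same]
  rw [hsize]
  obtain ⟨D, hD⟩ := Int.exists_eq_neg_ofNat (hle T)
  rw [hD, neg_neg]
  by_contra hlt
  rw [not_le] at hlt
  have hD2 : 2 ≤ D := by exact_mod_cast hlt
  -- the linear form is nonzero and homogeneous of degree one
  have hℓhom : ℓ.IsHomogeneous 1 := by
    rw [hℓdef]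
    refine IsHomogeneous.sum _ _ _ fun v _ => ?_
    rw [smul_eq_C_mul]
    exact (isHomogeneous_X k v).C_mul (c v)
  have hℓ0 : ℓ ≠ 0 := by
    intro h0
    apply hc
    have := congrArg (coeff (Finsupp.single T 1)) h0
    rw [hℓdef, coeff_zero] at this
    simp only [coeff_sum, coeff_smul, coeff_X, smul_eq_mul, mul_ite, mul_one, mul_zero] at this
    rw [Finset.sum_eq_single T (fun v _ hv => by
        rw [if_neg (fun h => hv (Finsupp.single_left_injective one_ne_zero h))])
      (fun h => absurd (Finset.mem_univ T) h), if_pos rfl] at this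
    exact this
  -- the splitting `χ = -ε_T + -(D-1) ε_T`
  have h1 : HasHighestWeight (orbitCoordRep ℓ 1) (Pi.single T (-(1 : ℤ))) := by
    have := hasHighestWeight_single_top_neg hT hℓhom hℓ0 1 le_rfl
    simpa using this
  have h2 : HasHighestWeight (orbitCoordRep ℓ 1) (Pi.single T (-((D - 1 : ℕ) : ℤ))) :=
    hasHighestWeight_single_top_neg hT hℓhom hℓ0 (D - 1) (by omega)
  have hsum : (Pi.single T (-(1 : ℤ)) : Weight σ) + Pi.single T (-((D - 1 : ℕ) : ℤ)) = χ := by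
    rw [hχ, hD, ← Pi.single_add]
    congr 1
    rw [Nat.cast_sub (by omega : 1 ≤ D)]
    push_cast
    ring
  have hne1 : (Pi.single T (-(1 : ℤ)) : Weight σ) ≠ 0 := by
    intro h
    have := congrFun h T
    simp at this
  have hne2 : (Pi.single T (-((D - 1 : ℕ) : ℤ)) : Weight σ) ≠ 0 := by
    intro h
    have := congrFun h T
    simp only [Pi.single_eq_same, Pi.zero_apply, neg_eq_zero, Nat.cast_eq_zero] at this
    omega
  have hatom := atom_of_genType_of_dense (dense_linearForm hT hc) hγ _ _ hsum hne1 hne2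
  rcases hatom with h | h
  · exact h1 h
  · exact h2 h

end DegreeOne


end

end Summit.ValiantsHypothesis.ValiantsHypothesis.Theorems.GeneratorObstructions.PowGenDegreeQP
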